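import Mathlib.Topology.MetricSpace.HausdorffDistance
import Summits.QuantumFields.BalabanUV.Beta.EriceFlowEnclosureB12AsPrintedPointwiseFadingRunRowsWitness
import Summits.QuantumFields.YangMills.Theorems.BalabanUVNodesK2NamedJetsRunRemAt

/-!
# THE SAWTOOTH FAMILY INSIDE NODE U2's LETTER CLASS AT `b⋆ = 0` — FILE A: the letters, (W) and (T) at every level
# (port with attribution of ym-nodeO P3 n°100 `SawtoothSeparationAtBstarZero-P3g55.lean` §0–§4, def-free)

Cell `pub-ymgap`, seat `pub-ymgap-dag-n13-w4` (g8), N13 [B16] width seat 4∕4; `--kind proof --supports stmt-QuantumFields-27364 --as helper` (K1⁹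
`…Theses.BalabanUVNodes.StabilityBRunRowsAtRecordR13SepCoPHV`, crux r3 DECIDING, route rev 29, skeleton v10).  FILE 5 of this lineage's END-EXACTNESS census (FILES 2–4: p626836
first kick · p628067 fading kick in the box · p634872 positive kick — witnesses OUTSIDE the β-flow team's letter class; this pair of files moves the separation INSIDE it).
PORT WITH ATTRIBUTION of the YM-NODE-O IDEATION cell's seat P3 («weaken the target») evidence n°100 `run/shared/lean/pub/ym-nodeO-ideate/memos/lines/SawtoothSeparationAtBstarZero-P3g55.lean`
(sha256 ab533756da1f4d30…, 497 l., g55; REF g65 PASS zero nits; evidence row 45 on stmt-QuantumFields-27364; bus `pub-ymgap/INBOX.md` l.39201 addressed «dag-n13-w4 FYI») — a planner seat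
files nothing under `Theorems/` (director-ym №31); P3's names are kept decl by decl.  DEF-FREE EDITION: P3's `Teeth` ∕ `toothDist` ∕ `betaSaw a` are read through DEFINING HYPOTHESES
`hT : T = Set.range (j ↦ 2^{-j})`, `hd : ∀ x, d x = Metric.infDist x T`, `hβ : ∀ k v, β k v = −a · d (v (Fin.last k))` (as FILES 2–4 read their kicks), instantiated once in FILE B's headline;
P3's `TopRunsAt` ∕ `TopRunsFamily` shapes are written inline.

THE OBJECT.  The β-flow team (pub-balaban prover 2; U2 = `T4CouplingMatching`'s `HistLipschitz` ∕ `FadingMemory` ∕ NE4 `ScaleShiftRate` + part 11's asymptotic constant `b⋆ = betaInf`)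
priced K1⁹'s ROWS `RunRowsCont13 F θ` at a tuple by ONE number: `0 < b⋆` sufficient, `0 ≤ b⋆` necessary, `b⋆ = 0` undecided; P3 n°99 showed the END-exact DIAL {(W), (T), (C)} has the
SAME price table.  THE SAWTOOTH FAMILY `β_{k+1}(g_0,…,g_k) = −a·dist(g_k, {2^{-j} : j ∈ ℕ})` (last-only, stationary, `≤ 0`, vanishing exactly on the dyadic teeth, slope `a ∈ ]0, 1]`)
sits INSIDE the class AT `b⋆ = 0` and separates them one step finer (FILE B): it carries every letter, (W), (T), rows (i)+(C), and NOT row (iv).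

THIS FILE (theorems only; 0 `def`): §1 the teeth and their distance function (1-Lipschitz, `≤ x`, the nearest-tooth band `[z, 3z∕2]`); §2 U2's letters for the family — `LastOnlyLipschitz a`,
`HistLipschitz` with diagonal moduli, `ScaleShiftRate 0`, `betaInf β (const u) = −a·dist(u, teeth)` hence **`b⋆ = 0`** with constant `C = a`, rows (i) (constant-history remainder) + (C) at
every level (part 12's `runRem_constHist_of_moduli` ∕ `survCont_of_moduli` BY NAME; the diagonal fading is `fadingMemory_diag` BY NAME, not restated); §3 (W) — constant runs sit on every
tooth in every window; §4 (T) at EVERY level `γ ≤ 1` with `g⋆(γ) = γ∕2` — the no-jump inequality `1∕g² + a(g − z) ≤ 1∕z²` (`0 ≤ a ≤ 1`, `0 < z ≤ g ≤ 1`): a run never jumps over the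
tooth below it.

HONEST FRAMING.  [folklore] real analysis over the tree's carriers (`FlowStep.HBeta` ∕ `RGEqH` ∕ `Box`, `Step.InInterval`, Mathlib `Metric.infDist`), CONDITIONAL on nothing (the letters are
PROVED for the toy family); node U2's letters themselves are HYPOTHESIS SHAPES about Bałaban's `E^{(j)}`, NOT printed ([Balaban1987RG1] p. 298 ∕ p. 264; GAPS G-t4-U2-1∕2); Bałaban's
β-functions have no teeth (expected POSITIVE, Thm 2 first sentence); NOTHING about `Node00.betaOfRecord₁₃`; nothing of Bałaban asserted; no item filed ∕ re-keyed (R-30: the dial stays a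
located reserve; HARD FREEZE after v10, director-ym №216); K1⁹ NOT closed (0∕6 stubs); N13 NOT discharged; counts UNMOVED (typed 28∕28 · discharged 5∕27 · A 5∕28).  One finite 𝕋⁴ programme
at fixed ε; R4 = the CONDITIONAL finite-𝕋⁴ rung `BalabanLadder.UV` only — the Yang–Mills mass gap (Clay) is NOT proved by any of this; nothing continuum ∕ ℝ⁴ ∕ OS.
No `sorry`, no `axiom`, no `def`, no `instance`, no `notation`.
Sources (locators only): [Balaban1987RG1] Commun. Math. Phys. 109 (1987) (0.20) p. 256, Thm 2 p. 259 (first sentence), §1 pp. 263–264 with (1.22), Thm 3 p. 264, (5.10) p. 293, §5 p. 298;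
[Balaban1989LargeFieldII] Commun. Math. Phys. 122 (1989) Thm 1 + (0.1) pp. 355–356 (where K1's rows are consumed).
-/

noncomputable section

open scoped BigOperators

namespace Summit.QuantumFields.YangMills.Theorems.BalabanUVNodesK1EndExactSawtoothLetters

open Finset Filter Topology
open Literature.MathematicalPhysics.QuantumFieldTheory.Balaban1983to89
open Literature.MathematicalPhysics.QuantumFieldTheory.Balaban1983to89.FlowStep (HBeta prefixOf prefixOf_apply Box mem_box RGEqH Y clampPrefix)
open Literature.MathematicalPhysics.QuantumFieldTheory.Balaban1983to89.T4CouplingMatching (HistLipschitz FadingMemory ScaleShiftRate LastOnlyLipschitz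
  fadingMemory_diag histLipschitz_of_lastOnly)
open Literature.MathematicalPhysics.QuantumFieldTheory.Balaban1983to89.T4BetaStationary (revHist betaInf)
open Summit.QuantumFields.BalabanUV.Beta.EriceFlowEnclosureB12AsPrintedPointwiseFadingRunRows (runRem_constHist_of_moduli survCont_of_moduli)
open Summit.QuantumFields.YangMills.Theorems.BalabanUVNodesK2NamedJetsRunRemAt (RunConstRemainder SurvCont Survivors)

variable {T : Set ℝ} {d : ℝ → ℝ} {β : HBeta} {a : ℝ}

/-! ## §1 The dyadic teeth `T = {2^{-j}}` and the distance `d = dist(·, T)` (read through `hT`, `hd`) — P3 n°100 §1 -/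

section Teeth

/-- every `2^{-j}` is a tooth. [folklore] -/
theorem pow_half_mem_teeth (hT : T = Set.range fun j : ℕ => ((1 : ℝ) / 2) ^ j) (j : ℕ) : ((1 : ℝ) / 2) ^ j ∈ T := by
  rw [hT]; exact ⟨j, rfl⟩

/-- the teeth are non-empty. [folklore] -/
theorem teeth_nonempty (hT : T = Set.range fun j : ℕ => ((1 : ℝ) / 2) ^ j) : T.Nonempty := ⟨1, by rw [hT]; exact ⟨0, by simp⟩⟩

/-- teeth are positive. [folklore] -/
theorem teeth_pos (hT : T = Set.range fun j : ℕ => ((1 : ℝ) / 2) ^ j) {t : ℝ} (ht : t ∈ T) : 0 < t := by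
  rw [hT] at ht; obtain ⟨j, rfl⟩ := ht; positivity

/-- teeth are `≤ 1`. [folklore] -/
theorem teeth_le_one (hT : T = Set.range fun j : ℕ => ((1 : ℝ) / 2) ^ j) {t : ℝ} (ht : t ∈ T) : t ≤ 1 := by
  rw [hT] at ht; obtain ⟨j, rfl⟩ := ht; exact pow_le_one₀ (by norm_num) (by norm_num)

/-- `0 ≤ dist(x, T)`. [folklore] -/
theorem toothDist_nonneg (hd : ∀ x, d x = Metric.infDist x T) (x : ℝ) : 0 ≤ d x := by
  rw [hd]; exact Metric.infDist_nonneg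

/-- `dist(t, T) = 0` on the teeth. [folklore] -/
theorem toothDist_of_mem (hd : ∀ x, d x = Metric.infDist x T) {t : ℝ} (ht : t ∈ T) : d t = 0 := by
  rw [hd]; exact Metric.infDist_zero_of_mem ht

/-- `dist(x, T) ≤ x − t` for any tooth `t ≤ x`. [folklore] -/
theorem toothDist_le_sub (hd : ∀ x, d x = Metric.infDist x T) {t x : ℝ} (ht : t ∈ T) (htx : t ≤ x) : d x ≤ x - t := by
  have h := Metric.infDist_le_dist_of_mem (x := x) ht
  rw [Real.dist_eq, abs_of_nonneg (sub_nonneg.mpr htx)] at h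
  rwa [hd]

/-- `dist(x, T) ≤ x` for `x > 0` (there are teeth below every positive number). [folklore] -/
theorem toothDist_le_self (hT : T = Set.range fun j : ℕ => ((1 : ℝ) / 2) ^ j) (hd : ∀ x, d x = Metric.infDist x T) {x : ℝ} (hx : 0 < x) : d x ≤ x := by
  obtain ⟨n, hn⟩ := exists_pow_lt_of_lt_one hx (by norm_num : (1 : ℝ) / 2 < 1)
  have h := toothDist_le_sub hd (pow_half_mem_teeth hT n) hn.le
  have : 0 ≤ ((1 : ℝ) / 2) ^ n := by positivity
  linarith

/-- `dist(·, T)` is 1-Lipschitz. [folklore] -/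
theorem abs_toothDist_sub_le (hd : ∀ x, d x = Metric.infDist x T) (x y : ℝ) : |d x - d y| ≤ |x - y| := by
  have h := (Metric.lipschitz_infDist_pt T).dist_le_mul x y
  rw [NNReal.coe_one, one_mul, Real.dist_eq, Real.dist_eq] at h
  rwa [hd, hd]

/-- **THE BAND OF A TOOTH**: between a tooth `z = 2^{-j}` and `(3∕2)·z` the nearest tooth is `z`, so `x − z ≤ dist(x, T)`. P3 n°100 `sub_le_toothDist`. [folklore] -/
theorem sub_le_toothDist (hT : T = Set.range fun j : ℕ => ((1 : ℝ) / 2) ^ j) (hd : ∀ x, d x = Metric.infDist x T) {j : ℕ} {x : ℝ}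
    (hzx : ((1 : ℝ) / 2) ^ j ≤ x) (hx : x ≤ 3 / 2 * ((1 : ℝ) / 2) ^ j) : x - ((1 : ℝ) / 2) ^ j ≤ d x := by
  set z : ℝ := ((1 : ℝ) / 2) ^ j with hz
  by_contra hlt
  have hlt' : Metric.infDist x T < x - z := by rw [← hd]; exact lt_of_not_ge hlt
  obtain ⟨t, ht, hdist⟩ := (Metric.infDist_lt_iff (teeth_nonempty hT)).mp hlt'
  rw [hT] at ht
  obtain ⟨i, rfl⟩ := ht
  rw [Real.dist_eq] at hdist
  rcases Nat.lt_or_ge i j with hij | hji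
  · -- a tooth at or above 2z
    have hi1 : i + 1 ≤ j := hij
    have hti : 2 * z ≤ ((1 : ℝ) / 2) ^ i := by
      have h1 : ((1 : ℝ) / 2) ^ j ≤ ((1 : ℝ) / 2) ^ (i + 1) := pow_le_pow_of_le_one (by norm_num) (by norm_num) hi1
      rw [pow_succ] at h1
      linarith
    have : x - z ≤ |x - ((1 : ℝ) / 2) ^ i| := by
      rw [abs_of_nonpos (by linarith)]; linarith
    linarith
  · -- a tooth at or below z
    have hti : ((1 : ℝ) / 2) ^ i ≤ z := pow_le_pow_of_le_one (by norm_num) (by norm_num) hji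
    have : x - z ≤ |x - ((1 : ℝ) / 2) ^ i| := by
      rw [abs_of_nonneg (by linarith)]; linarith
    linarith

end Teeth

/-! ## §2 Node U2's letters for the sawtooth family `β k v = −a·d(v (Fin.last k))`, all present, with `b⋆ = 0` — P3 n°100 §2 -/

section Letters

/-- the sawtooth family is LAST-ONLY LIPSCHITZ with constant `a` on every box (`T4CouplingMatching.LastOnlyLipschitz`). P3 n°100 `lastOnlyLipschitz_saw`. [folklore] -/
theorem lastOnlyLipschitz_saw (hd : ∀ x, d x = Metric.infDist x T) (hβ : ∀ (k : ℕ) (v : Fin (k + 1) → ℝ), β k v = -a * d (v (Fin.last k)))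
    (ha : 0 ≤ a) (γ : ℝ) : LastOnlyLipschitz a γ β := by
  intro k p q _ _
  have : β k p - β k q = -a * (d (p (Fin.last k)) - d (q (Fin.last k))) := by rw [hβ, hβ]; ring
  rw [this, abs_mul, abs_neg, abs_of_nonneg ha]
  exact mul_le_mul_of_nonneg_left (abs_toothDist_sub_le hd _ _) ha

/-- hence node U2's HISTORY MODULUS with the DIAGONAL moduli `Λ k i = a·𝟙[i = k]` on every box (`histLipschitz_of_lastOnly` BY NAME); these moduli fade at every rate `θ ≥ 0` with constant
`a` (`fadingMemory_diag` BY NAME — not restated). P3 n°100 `histLipschitz_saw`. [folklore] -/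
theorem histLipschitz_saw (hd : ∀ x, d x = Metric.infDist x T) (hβ : ∀ (k : ℕ) (v : Fin (k + 1) → ℝ), β k v = -a * d (v (Fin.last k)))
    (ha : 0 ≤ a) (γ : ℝ) : HistLipschitz (fun k i => if i = k then a else 0) γ β :=
  histLipschitz_of_lastOnly (lastOnlyLipschitz_saw hd hβ ha γ)

/-- NE4 at rate ZERO: `ScaleShiftRate 0 θ γ β` — the family is stationary and last-only, so `β (k+1) w = β k (Fin.tail w)`. P3 n°100 `scaleShiftRate_saw`. [folklore] -/
theorem scaleShiftRate_saw (hβ : ∀ (k : ℕ) (v : Fin (k + 1) → ℝ), β k v = -a * d (v (Fin.last k))) (θ γ : ℝ) : ScaleShiftRate 0 θ γ β := by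
  intro k w _
  have htail : Fin.tail w (Fin.last k) = w (Fin.last (k + 1)) := by
    rw [Fin.tail, Fin.succ_last]
  simp only [hβ, htail, sub_self, abs_zero, zero_mul, le_refl]

/-- part 11's asymptotic constant along the CONSTANT history `u`: `betaInf β (const u) = −a·dist(u, T)` (the sequence is constant). P3 n°100 `betaInf_saw`. [folklore] -/
theorem betaInf_saw (hβ : ∀ (k : ℕ) (v : Fin (k + 1) → ℝ), β k v = -a * d (v (Fin.last k))) (u : ℝ) :
    betaInf β (fun _ : ℕ => u) = -a * d u := by
  unfold betaInf
  have h : (fun k : ℕ => β k (revHist (fun _ : ℕ => u) k)) = fun _ : ℕ => -a * d u := by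
    funext k
    rw [hβ]
    simp [revHist]
  rw [h]
  exact tendsto_const_nhds.limUnder_eq

/-- **`b⋆ = 0`** for the sawtooth family — part 11's property with limit `0` and constant `C = a`, on every box, at every rate `0 ≤ θ < 1`: `|betaInf β (const u) − 0| ≤ a·u∕(1−θ)` for
`0 < u ≤ γ` (since `dist(u, T) ≤ u`). P3 n°100 `bstar_zero_saw`. [folklore] -/
theorem bstar_zero_saw (hT : T = Set.range fun j : ℕ => ((1 : ℝ) / 2) ^ j) (hd : ∀ x, d x = Metric.infDist x T)
    (hβ : ∀ (k : ℕ) (v : Fin (k + 1) → ℝ), β k v = -a * d (v (Fin.last k))) (ha : 0 ≤ a) {θ : ℝ} (hθ0 : 0 ≤ θ) (hθ1 : θ < 1) (γ : ℝ) :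
    ∀ u : ℝ, 0 < u → u ≤ γ → |betaInf β (fun _ : ℕ => u) - 0| ≤ a * u / (1 - θ) := by
  intro u hu _
  have h1θ : 0 < 1 - θ := by linarith
  have hd0 := toothDist_nonneg hd u
  have hdu := toothDist_le_self hT hd hu
  rw [betaInf_saw hβ, sub_zero, neg_mul, abs_neg, abs_of_nonneg (mul_nonneg ha hd0), le_div_iff₀ h1θ]
  have h1 : a * d u ≤ a * u := mul_le_mul_of_nonneg_left hdu ha
  have h2 : 0 ≤ a * d u * θ := mul_nonneg (mul_nonneg ha hd0) hθ0
  nlinarith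

/-- **ROWS (i) AND (C) AT EVERY LEVEL** for the sawtooth family — row (i) as the constant-history remainder `|β k (run prefix) − β k (const γ₀)| ≤ a·γ₀∕(1−θ)` and (C) `SurvCont β γ₀` — the
β-flow team's part-12 suppliers `runRem_constHist_of_moduli` ∕ `survCont_of_moduli` BY NAME on the diagonal moduli. P3 n°100 `rowI_and_C_saw`. [folklore] -/
theorem rowI_and_C_saw (hd : ∀ x, d x = Metric.infDist x T) (hβ : ∀ (k : ℕ) (v : Fin (k + 1) → ℝ), β k v = -a * d (v (Fin.last k))) (ha : 0 ≤ a)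
    {θ γ₀ : ℝ} (hθ0 : 0 ≤ θ) (hθ1 : θ < 1) (hγ₀ : 0 < γ₀) :
    (∀ (n : ℕ) (gs : ℕ → ℝ), RGEqH n β gs → Step.InInterval γ₀ n gs →
        ∀ k, k ≤ n → |β k (prefixOf gs k) - β k (fun _ : Fin (k + 1) => γ₀)| ≤ a * γ₀ / (1 - θ)) ∧
      SurvCont β γ₀ :=
  ⟨runRem_constHist_of_moduli (histLipschitz_saw hd hβ ha γ₀) (fadingMemory_diag ha hθ0) hθ0 hθ1 ha hγ₀ le_rfl,
    survCont_of_moduli (histLipschitz_saw hd hβ ha γ₀) hγ₀ le_rfl⟩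

end Letters

/-! ## §3 (W): constant runs sit on every tooth, in every window — P3 n°100 §3 -/

section WindowRuns

/-- **(W) AT EVERY LEVEL**: for `0 < γ` and every length `K`, the constant sequence at a tooth `2^{-n} < γ` solves (0.20) (the family vanishes on the teeth) inside `]0, γ]`.
P3 n°100 `constRun_saw`. [cite: Balaban1987RG1, (0.17)–(0.20) pp.255–256 (the recursion only; elementary)] -/
theorem constRun_saw (hT : T = Set.range fun j : ℕ => ((1 : ℝ) / 2) ^ j) (hd : ∀ x, d x = Metric.infDist x T)
    (hβ : ∀ (k : ℕ) (v : Fin (k + 1) → ℝ), β k v = -a * d (v (Fin.last k))) {γ : ℝ} (hγ : 0 < γ) (K : ℕ) :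
    ∃ gs : ℕ → ℝ, RGEqH K β gs ∧ Step.InInterval γ K gs := by
  obtain ⟨n, hn⟩ := exists_pow_lt_of_lt_one hγ (by norm_num : (1 : ℝ) / 2 < 1)
  refine ⟨fun _ => ((1 : ℝ) / 2) ^ n, ?_, ?_⟩
  · intro k _
    rw [hβ, prefixOf_apply, toothDist_of_mem hd (pow_half_mem_teeth hT n), mul_zero, add_zero]
  · intro k _
    exact ⟨by positivity, hn.le⟩

end WindowRuns

/-! ## §4 (T) at EVERY level `γ ≤ 1`: a run never jumps over the tooth below it — P3 n°100 §4 -/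

section TopRuns

/-- **THE NO-JUMP INEQUALITY**: for `0 ≤ a ≤ 1` and `0 < z ≤ g ≤ 1`, `1∕g² + a(g − z) ≤ 1∕z²`. P3 n°100 `no_jump`. [folklore] -/
theorem no_jump {a z g : ℝ} (ha0 : 0 ≤ a) (ha1 : a ≤ 1) (hz : 0 < z) (hzg : z ≤ g) (hg1 : g ≤ 1) :
    1 / g ^ 2 + a * (g - z) ≤ 1 / z ^ 2 := by
  have hg : 0 < g := lt_of_lt_of_le hz hzg
  have hz1 : z ≤ 1 := hzg.trans hg1
  have hkey : a * (g - z) * (g ^ 2 * z ^ 2) ≤ g ^ 2 - z ^ 2 := by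
    have h1 : a * (g ^ 2 * z ^ 2) ≤ g + z := by
      have h2 : g ^ 2 * z ^ 2 ≤ g := by nlinarith [mul_nonneg hg.le hz.le, sq_nonneg z, mul_le_one₀ hg1 hz.le hz1]
      nlinarith
    nlinarith [sub_nonneg.mpr hzg]
  rw [div_add' _ _ _ (by positivity), div_le_div_iff₀ (by positivity) (by positivity)]
  nlinarith [hkey]

/-- **ONCE AT OR ABOVE A TOOTH, FOREVER AT OR ABOVE IT**: along an in-window solution of (0.20) for the sawtooth family at a level `γ ≤ 1` (slope `0 ≤ a ≤ 1`), `t ≤ g_k` for a tooth `t`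
gives `t ≤ g_m` for all `k ≤ m ≤ n` (the step adds `a·dist(g_m, T) ≤ a(g_m − t)` to `g_m⁻²`, and the no-jump inequality caps the result by `t⁻²`). P3 n°100 `stays_above_tooth`.
[cite: Balaban1987RG1, (0.20) p.256 (the recursion only; elementary)] -/
theorem stays_above_tooth (hT : T = Set.range fun j : ℕ => ((1 : ℝ) / 2) ^ j) (hd : ∀ x, d x = Metric.infDist x T)
    (hβ : ∀ (k : ℕ) (v : Fin (k + 1) → ℝ), β k v = -a * d (v (Fin.last k))) (ha0 : 0 ≤ a) (ha1 : a ≤ 1) {t : ℝ} (ht : t ∈ T) {γ : ℝ} (hγ1 : γ ≤ 1)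
    {n : ℕ} {gs : ℕ → ℝ} (hrg : RGEqH n β gs) (hI : Step.InInterval γ n gs) {k : ℕ} (htk : t ≤ gs k) :
    ∀ m, k ≤ m → m ≤ n → t ≤ gs m := by
  intro m hkm hmn
  induction m, hkm using Nat.le_induction with
  | base => exact htk
  | succ m hkm ih =>
    have hm : m < n := Nat.lt_of_succ_le hmn
    have htm : t ≤ gs m := ih hm.le
    have hgm1 : gs m ≤ 1 := (hI m hm.le).2.trans hγ1
    have hpos1 : 0 < gs (m + 1) := (hI (m + 1) hmn).1
    have htpos : 0 < t := teeth_pos hT ht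
    have hstep : 1 / (gs (m + 1)) ^ 2 = 1 / (gs m) ^ 2 + a * d (gs m) := by
      have h := hrg m hm
      rw [hβ, prefixOf_apply, Fin.val_last] at h
      linarith
    have hle : 1 / (gs (m + 1)) ^ 2 ≤ 1 / t ^ 2 := by
      rw [hstep]
      have h3 : a * d (gs m) ≤ a * (gs m - t) := mul_le_mul_of_nonneg_left (toothDist_le_sub hd ht htm) ha0
      have h4 := no_jump ha0 ha1 htpos htm hgm1
      linarith
    have hsq : t ^ 2 ≤ (gs (m + 1)) ^ 2 := (one_div_le_one_div (by positivity) (by positivity)).mp hle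
    calc t = Real.sqrt (t ^ 2) := (Real.sqrt_sq htpos.le).symm
      _ ≤ Real.sqrt ((gs (m + 1)) ^ 2) := Real.sqrt_le_sqrt hsq
      _ = gs (m + 1) := Real.sqrt_sq hpos1.le

/-- **(T) AT EVERY LEVEL `0 < γ ≤ 1` WITH THRESHOLD `g⋆(γ) = γ∕2`** (P3's `TopRunsAt (γ∕2) γ β`, written inline): an in-`]0,γ]` solution of (0.20) that touches the top `γ` at some scale
never ends below `γ∕2` — it stays above the largest tooth `2^{-(m+1)} ∈ ]γ∕2, γ[` below `γ`. P3 n°100 `topRunsAt_saw`. [cite: Balaban1987RG1, Thm 2 p.259 (first sentence), (0.20) p.256 (the letter; elementary)] -/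
theorem topRunsAt_saw (hT : T = Set.range fun j : ℕ => ((1 : ℝ) / 2) ^ j) (hd : ∀ x, d x = Metric.infDist x T)
    (hβ : ∀ (k : ℕ) (v : Fin (k + 1) → ℝ), β k v = -a * d (v (Fin.last k))) (ha0 : 0 ≤ a) (ha1 : a ≤ 1) {γ : ℝ} (hγ : 0 < γ) (hγ1 : γ ≤ 1) :
    ∀ (n : ℕ) (gs : ℕ → ℝ), RGEqH n β gs → Step.InInterval γ n gs → ∀ k, k ≤ n → gs k = γ → γ / 2 ≤ gs n := by
  intro n gs hrg hI k hk hkγ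
  obtain ⟨m, hm1, hm2⟩ := exists_nat_pow_near_of_lt_one hγ hγ1 (by norm_num : (0 : ℝ) < 1 / 2) (by norm_num : (1 : ℝ) / 2 < 1)
  have htk : ((1 : ℝ) / 2) ^ (m + 1) ≤ gs k := by rw [hkγ]; exact hm1.le
  have h := stays_above_tooth hT hd hβ ha0 ha1 (pow_half_mem_teeth hT (m + 1)) hγ1 hrg hI htk n hk le_rfl
  have h2 : γ / 2 ≤ ((1 : ℝ) / 2) ^ (m + 1) := by rw [pow_succ]; linarith
  exact h2.trans h

/-- **(T) ON THE WHOLE OF `]0, 1]`** (P3's `TopRunsFamily 1 β`, inline): a positive top-run threshold at every level `γ ≤ 1`. P3 n°100 `topRunsFamily_saw`.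
[cite: Balaban1987RG1, Thm 2 p.259 (first sentence), (0.20) p.256 (the letter; elementary)] -/
theorem topRunsFamily_saw (hT : T = Set.range fun j : ℕ => ((1 : ℝ) / 2) ^ j) (hd : ∀ x, d x = Metric.infDist x T)
    (hβ : ∀ (k : ℕ) (v : Fin (k + 1) → ℝ), β k v = -a * d (v (Fin.last k))) (ha0 : 0 ≤ a) (ha1 : a ≤ 1) :
    ∀ γ : ℝ, 0 < γ → γ ≤ 1 → ∃ gstar : ℝ, 0 < gstar ∧
      ∀ (n : ℕ) (gs : ℕ → ℝ), RGEqH n β gs → Step.InInterval γ n gs → ∀ k, k ≤ n → gs k = γ → gstar ≤ gs n :=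
  fun γ hγ hγ1 => ⟨γ / 2, by positivity, topRunsAt_saw hT hd hβ ha0 ha1 hγ hγ1⟩

end TopRuns

end Summit.QuantumFields.YangMills.Theorems.BalabanUVNodesK1EndExactSawtoothLetters

end
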